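import Mathlib
import HarnessLib
import Summits.NavierStokesRegularity.NavierStokesRegularity.Theorems.PoloidalWindowDoorPoloidalWindowRigidityHotHullCompactness
import Summits.NavierStokesRegularity.NavierStokesRegularity.Theorems.PoloidalWindowDoorPoloidalWindowRigidityHotHullSliding
import Summits.NavierStokesRegularity.NavierStokesRegularity.Theorems.PoloidalWindowDoorLrcModEntireRidgeHullIterate

/-!
# Item `LrcModEntire` (stmt-NavierStokesRegularity-20428) / crux `PoloidalWindowRigidity` (19708) — the SLIDE along a hot branch as an action on PAIRS:
# flow law, tag bookkeeping, and the re-entry package of a slid pair (tools for the recurrent upgrade of the (Q4) object, DIRECTOR-NS #301 (A)(1))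

Seat ns-poloidal-K2-p2 g15 (`--supports stmt-NavierStokesRegularity-19708 --as helper`).  A pair is `(U, g)`: a space–time profile `U` and a continuous tag
`g : ℝ³ → ℝ³`; a branch `Γ : ℝ → ℝ³` is carried as the tag `x ↦ Γ (x 0)` (read through the first coordinate), so that the generic pair-Birkhoff wrapper
`…HullBirkhoffPair.exists_recurrent_of_pairAction` applies.  The SLIDE by `σ` is `Φ σ (U, g) = (U(·, · + g(σe₀)), g(· + σe₀) − g(σe₀))`; on a branch tag this is
`(U(·, · + Γ σ), Γ(· + σ) − Γ σ)` read through the first coordinate.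

* `slide_add` — the flow law `Φ (s + t) = Φ s ∘ Φ t` (all pairs, pure algebra).
* `tag_apply_smul_e0`, `tag_slide_apply` — reading a branch tag.
* `tendstoLocallyUniformly_tag`, `tendstoLocallyUniformly_of_tag` — locally uniform convergence of branches ⇔ of their tags.
* `tendstoLocallyUniformly_of_lipschitz_tendsto` — for uniformly Lipschitz curves pointwise convergence is locally uniform (Arzelà–Ascoli, elementary form).
* `fderiv_fderiv_comp_add_right` — the Hessian of a translate.
* `reentry_slide` — the slid pair of a pinned peakless profile with port-2's RE-ENTRY PACKAGE (`…RidgeHullIterate.exists_hullLimit_branch_reentry`) is again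
  pinned (H1a `pinned_translate` at the hot critical point `Γ σ`), peakless (H1b), has the same hot value, and carries the re-entry package for the re-based
  branch `Γ(· + σ) − Γ σ`.

WHAT THIS IS NOT: not a claim about Navier–Stokes regularity — bookkeeping for supports of a door route (bears_on LADDER-NS N0, item 20428 / crux 19708;
both OPEN; the research cell (Q4) OPEN; NS regularity NOT proved).
-/

noncomputable section

-- the summit and its single sub-problem share the name (CONVENTIONS §1), as in every Theorems file
set_option linter.dupNamespace false

namespace Summit.NavierStokesRegularity.NavierStokesRegularity.Theorems.PoloidalWindowDoorLrcModEntireRidgeWebRecurrentSlide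

open Set Function Filter Topology Metric
open scoped InnerProductSpace RealInnerProductSpace Laplacian NNReal ContDiff
open Literature.Analysis Literature.Analysis.FluidPDE Literature.Analysis.UnboundedOperators
open Summit.NavierStokesRegularity.NavierStokesRegularity.Theorems
open PoloidalWindowDoorPoloidalWindowRigidityHotHullCompactness PoloidalWindowDoorPoloidalWindowRigidityHotHullSliding
  PoloidalWindowDoorLrcModEntireRidgeHullIterate

/-! ### Reading a branch through the first coordinate -/

/-- `(s • e₀) 0 = s`. -/
theorem smul_e0_apply_zero (s : ℝ) : (s • EuclideanSpace.single (0 : Fin 3) (1 : ℝ)) 0 = s := by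
  simp

/-- `(x + s • e₀) 0 = x 0 + s`. -/
theorem add_smul_e0_apply_zero (x : EuclideanSpace ℝ (Fin 3)) (s : ℝ) :
    (x + s • EuclideanSpace.single (0 : Fin 3) (1 : ℝ)) 0 = x 0 + s := by
  simp

/-- The branch tag evaluated at `σ e₀` is the branch point `Γ σ`. -/
theorem tag_apply_smul_e0 (Γ : ℝ → EuclideanSpace ℝ (Fin 3)) (σ : ℝ) :
    (fun x : EuclideanSpace ℝ (Fin 3) => Γ (x 0)) (σ • EuclideanSpace.single (0 : Fin 3) (1 : ℝ)) = Γ σ := by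
  simp

/-- The slid tag of a branch tag is the tag of the re-based branch. -/
theorem tag_slide (Γ : ℝ → EuclideanSpace ℝ (Fin 3)) (σ : ℝ) :
    (fun x : EuclideanSpace ℝ (Fin 3) => (fun y : EuclideanSpace ℝ (Fin 3) => Γ (y 0)) (x + σ • EuclideanSpace.single (0 : Fin 3) (1 : ℝ)) -
        (fun y : EuclideanSpace ℝ (Fin 3) => Γ (y 0)) (σ • EuclideanSpace.single (0 : Fin 3) (1 : ℝ))) =
      fun x : EuclideanSpace ℝ (Fin 3) => (fun s => Γ (s + σ) - Γ σ) (x 0) := by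
  funext x
  simp

/-! ### The flow law of the slide on pairs -/

/-- **The slide is an `ℝ`-action on pairs**: `Φ (s + t) = Φ s ∘ Φ t`, where `Φ σ (U, g) = (U(·, · + g(σe₀)), g(· + σe₀) − g(σe₀))`. -/
theorem slide_add (p : (ℝ → EuclideanSpace ℝ (Fin 3) → EuclideanSpace ℝ (Fin 3)) × (EuclideanSpace ℝ (Fin 3) → EuclideanSpace ℝ (Fin 3))) (s t : ℝ) :
    (fun (σ : ℝ) (q : (ℝ → EuclideanSpace ℝ (Fin 3) → EuclideanSpace ℝ (Fin 3)) × (EuclideanSpace ℝ (Fin 3) → EuclideanSpace ℝ (Fin 3))) =>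
        ((fun τ x => q.1 τ (x + q.2 (σ • EuclideanSpace.single (0 : Fin 3) (1 : ℝ))),
          fun x => q.2 (x + σ • EuclideanSpace.single (0 : Fin 3) (1 : ℝ)) - q.2 (σ • EuclideanSpace.single (0 : Fin 3) (1 : ℝ))) :
          (ℝ → EuclideanSpace ℝ (Fin 3) → EuclideanSpace ℝ (Fin 3)) × (EuclideanSpace ℝ (Fin 3) → EuclideanSpace ℝ (Fin 3)))) (s + t) p =
      (fun (σ : ℝ) (q : (ℝ → EuclideanSpace ℝ (Fin 3) → EuclideanSpace ℝ (Fin 3)) × (EuclideanSpace ℝ (Fin 3) → EuclideanSpace ℝ (Fin 3))) =>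
        ((fun τ x => q.1 τ (x + q.2 (σ • EuclideanSpace.single (0 : Fin 3) (1 : ℝ))),
          fun x => q.2 (x + σ • EuclideanSpace.single (0 : Fin 3) (1 : ℝ)) - q.2 (σ • EuclideanSpace.single (0 : Fin 3) (1 : ℝ))) :
          (ℝ → EuclideanSpace ℝ (Fin 3) → EuclideanSpace ℝ (Fin 3)) × (EuclideanSpace ℝ (Fin 3) → EuclideanSpace ℝ (Fin 3)))) s
        ((fun (σ : ℝ) (q : (ℝ → EuclideanSpace ℝ (Fin 3) → EuclideanSpace ℝ (Fin 3)) × (EuclideanSpace ℝ (Fin 3) → EuclideanSpace ℝ (Fin 3))) =>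
          ((fun τ x => q.1 τ (x + q.2 (σ • EuclideanSpace.single (0 : Fin 3) (1 : ℝ))),
            fun x => q.2 (x + σ • EuclideanSpace.single (0 : Fin 3) (1 : ℝ)) - q.2 (σ • EuclideanSpace.single (0 : Fin 3) (1 : ℝ))) :
            (ℝ → EuclideanSpace ℝ (Fin 3) → EuclideanSpace ℝ (Fin 3)) × (EuclideanSpace ℝ (Fin 3) → EuclideanSpace ℝ (Fin 3)))) t p) := by
  set e₀ : EuclideanSpace ℝ (Fin 3) := EuclideanSpace.single (0 : Fin 3) (1 : ℝ) with he₀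
  simp only [Prod.mk.injEq]
  constructor
  · funext τ x
    simp only [add_smul]
    abel
  · funext x
    simp only [add_smul, ← add_assoc]
    abel

/-! ### Locally uniform convergence: branches versus tags, and the Lipschitz upgrade -/

/-- Branch convergence gives tag convergence (compose with the continuous first-coordinate map). -/
theorem tendstoLocallyUniformly_tag {ι : Type*} {p : Filter ι} {Γs : ι → ℝ → EuclideanSpace ℝ (Fin 3)} {Γ : ℝ → EuclideanSpace ℝ (Fin 3)}
    (h : TendstoLocallyUniformly Γs Γ p) :
    TendstoLocallyUniformly (fun k (x : EuclideanSpace ℝ (Fin 3)) => Γs k (x 0)) (fun x => Γ (x 0)) p := by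
  have hc : Continuous fun x : EuclideanSpace ℝ (Fin 3) => x 0 := (EuclideanSpace.proj (0 : Fin 3)).continuous
  exact h.comp (fun x : EuclideanSpace ℝ (Fin 3) => x 0) hc

/-- Tag convergence gives branch convergence (compose with `s ↦ s e₀`). -/
theorem tendstoLocallyUniformly_of_tag {ι : Type*} {p : Filter ι} {Γs : ι → ℝ → EuclideanSpace ℝ (Fin 3)} {Γ : ℝ → EuclideanSpace ℝ (Fin 3)}
    (h : TendstoLocallyUniformly (fun k (x : EuclideanSpace ℝ (Fin 3)) => Γs k (x 0)) (fun x => Γ (x 0)) p) :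
    TendstoLocallyUniformly Γs Γ p := by
  have hc : Continuous fun s : ℝ => s • EuclideanSpace.single (0 : Fin 3) (1 : ℝ) := continuous_id.smul continuous_const
  have h2 := h.comp (fun s : ℝ => s • EuclideanSpace.single (0 : Fin 3) (1 : ℝ)) hc
  have e1 : (fun n => (fun x : EuclideanSpace ℝ (Fin 3) => Γs n (x 0)) ∘ fun s : ℝ => s • EuclideanSpace.single (0 : Fin 3) (1 : ℝ)) = Γs := by
    funext n s; simp
  have e2 : ((fun x : EuclideanSpace ℝ (Fin 3) => Γ (x 0)) ∘ fun s : ℝ => s • EuclideanSpace.single (0 : Fin 3) (1 : ℝ)) = Γ := by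
    funext s; simp
  rw [e1, e2] at h2
  exact h2

/-- **Arzelà–Ascoli, elementary form: for uniformly Lipschitz curves, pointwise convergence is locally uniform.** [folklore] -/
theorem tendstoLocallyUniformly_of_lipschitz_tendsto {V : Type*} [PseudoMetricSpace V] {K : ℝ≥0} {Γs : ℕ → ℝ → V} {Γ : ℝ → V}
    (hL : ∀ k, LipschitzWith K (Γs k)) (hpt : ∀ s, Tendsto (fun k => Γs k s) atTop (𝓝 (Γ s))) :
    TendstoLocallyUniformly Γs Γ atTop := by
  -- the limit is `K`-Lipschitz
  have hΓL : LipschitzWith K Γ := by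
    refine LipschitzWith.of_dist_le_mul fun a b => ?_
    have h := Filter.Tendsto.dist (hpt a) (hpt b)
    exact le_of_tendsto' h fun k => (hL k).dist_le_mul a b
  rw [tendstoLocallyUniformly_iff_forall_isCompact]
  intro S hS
  rw [Metric.tendstoUniformlyOn_iff]
  intro ε hε
  -- a finite `δ`-net of the compact set
  have hδ : 0 < ε / (3 * ((K : ℝ) + 1)) := by positivity
  obtain ⟨T, hTS, hTfin, hcover⟩ := hS.finite_cover_balls hδ
  have hev : ∀ᶠ k in atTop, ∀ c ∈ T, dist (Γ c) (Γs k c) < ε / 3 := by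
    have : ∀ c ∈ T, ∀ᶠ k in atTop, dist (Γ c) (Γs k c) < ε / 3 := fun c _ => by
      have h := (hpt c)
      rw [Metric.tendsto_nhds] at h
      filter_upwards [h (ε / 3) (by positivity)] with k hk
      rw [dist_comm]; exact hk
    exact (hTfin.eventually_all).2 this
  filter_upwards [hev] with k hk s hs
  obtain ⟨c, hcT, hsc⟩ := mem_iUnion₂.1 (hcover hs)
  have hsc' : dist s c < ε / (3 * ((K : ℝ) + 1)) := mem_ball.1 hsc
  have hK1 : (K : ℝ) * (ε / (3 * ((K : ℝ) + 1))) ≤ ε / 3 := by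
    rw [mul_div_assoc', div_le_div_iff₀ (by positivity) (by positivity)]
    nlinarith [K.coe_nonneg, hε.le]
  have h1 : dist (Γ s) (Γ c) ≤ ε / 3 :=
    ((hΓL.dist_le_mul s c).trans (mul_le_mul_of_nonneg_left hsc'.le K.coe_nonneg)).trans hK1
  have h3 : dist (Γs k c) (Γs k s) ≤ ε / 3 := by
    rw [dist_comm]
    exact (((hL k).dist_le_mul s c).trans (mul_le_mul_of_nonneg_left hsc'.le K.coe_nonneg)).trans hK1
  calc dist (Γ s) (Γs k s) ≤ dist (Γ s) (Γ c) + dist (Γ c) (Γs k c) + dist (Γs k c) (Γs k s) := dist_triangle4 _ _ _ _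
    _ < ε / 3 + ε / 3 + ε / 3 := by linarith [hk c hcT]
    _ = ε := by ring

/-- A unit-speed `C¹` curve is `1`-Lipschitz. -/
theorem lipschitzWith_one_of_unit {V : Type*} [NormedAddCommGroup V] [NormedSpace ℝ V] {Γ : ℝ → V} (hΓ : Differentiable ℝ Γ)
    (hunit : ∀ s, ‖deriv Γ s‖ = 1) : LipschitzWith 1 Γ := by
  refine LipschitzWith.of_dist_le_mul fun a b => ?_
  have h := (convex_univ).norm_image_sub_le_of_norm_deriv_le (fun x _ => hΓ x) (fun x _ => (hunit x).le) (mem_univ b) (mem_univ a)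
  rw [dist_eq_norm, dist_eq_norm]
  simpa using h

/-- Re-based curves `s ↦ γ (b + s) − γ b` of a unit-speed `C¹` curve are `1`-Lipschitz. -/
theorem lipschitzWith_one_rebased {V : Type*} [NormedAddCommGroup V] [NormedSpace ℝ V] {γ : ℝ → V} (hγ : Differentiable ℝ γ)
    (hunit : ∀ s, ‖deriv γ s‖ = 1) (b : ℝ) : LipschitzWith 1 fun s => γ (b + s) - γ b := by
  have h1 := lipschitzWith_one_of_unit hγ hunit
  refine LipschitzWith.of_dist_le_mul fun a c => ?_
  rw [dist_eq_norm, sub_sub_sub_cancel_right, ← dist_eq_norm]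
  have := h1.dist_le_mul (b + a) (b + c)
  simpa using this

/-! ### The Hessian of a translate -/

/-- `D²(f(· + c))(x) = D²f(x + c)`. [folklore] -/
theorem fderiv_fderiv_comp_add_right {E F : Type*} [NormedAddCommGroup E] [NormedSpace ℝ E] [NormedAddCommGroup F] [NormedSpace ℝ F]
    (f : E → F) (c x : E) :
    fderiv ℝ (fderiv ℝ (fun y => f (y + c))) x = fderiv ℝ (fderiv ℝ f) (x + c) := by
  have e : fderiv ℝ (fun y => f (y + c)) = fun y => fderiv ℝ f (y + c) := by
    funext y; exact fderiv_comp_add_right c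
  rw [e, fderiv_comp_add_right]

/-! ### The re-entry package of a slid pair -/

/-- The re-based branch `s ↦ Γ (s + σ) − Γ σ`: smooth, based at `0`, planar, unit speed, with derivative `Γ′(s + σ)`. -/
theorem rebased_branch_facts {Γ : ℝ → EuclideanSpace ℝ (Fin 3)} (hΓ : ContDiff ℝ ∞ Γ) (hplane : ∀ s, Γ s 2 = 0) (hunit : ∀ s, ‖deriv Γ s‖ = 1) (σ : ℝ) :
    ContDiff ℝ ∞ (fun s => Γ (s + σ) - Γ σ) ∧ (fun s => Γ (s + σ) - Γ σ) 0 = 0 ∧ (∀ s, (fun s => Γ (s + σ) - Γ σ) s 2 = 0) ∧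
      (∀ s, deriv (fun s => Γ (s + σ) - Γ σ) s = deriv Γ (s + σ)) ∧ (∀ s, ‖deriv (fun s => Γ (s + σ) - Γ σ) s‖ = 1) := by
  have hd : ∀ s, deriv (fun s => Γ (s + σ) - Γ σ) s = deriv Γ (s + σ) := fun s => by
    rw [deriv_sub_const, deriv_comp_add_const]
  refine ⟨(hΓ.comp (contDiff_id.add contDiff_const)).sub contDiff_const, by simp, fun s => ?_, hd, fun s => by rw [hd]; exact hunit _⟩
  show (Γ (s + σ) - Γ σ) 2 = 0
  rw [PiLp.sub_apply, hplane, hplane, sub_zero]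

/-- **The slid pair re-enters.**  `U` pinned and peakless (unfolded as in `…HotHullCompactness`) with port-2's re-entry package for `(U, Γ)`; then for every `σ`
the slid profile `U(·, · + Γ σ)` is pinned, peakless, has the same hot value, and `(U(·, · + Γ σ), Γ(· + σ) − Γ σ)` carries the re-entry package. -/
theorem reentry_slide {C : ℝ} {U : ℝ → EuclideanSpace ℝ (Fin 3) → EuclideanSpace ℝ (Fin 3)}
    (hP : (Literature.Analysis.FluidPDE.HasTypeITimeDecay C U ∧
        ContinuousOn (Function.uncurry U) (Set.Iio (0 : ℝ) ×ˢ Set.univ) ∧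
        (∀ s t : ℝ, s < t → t < 0 → ∀ x, U t x =
          Literature.Analysis.UnboundedOperators.heatExtension (U s) (t - s) x -
            Literature.Analysis.FluidPDE.oseenDuhamel 1 s U U t x) ∧
        (∀ t < 0, Literature.Analysis.FluidPDE.VectorCalculus.IsDivFree (U t)) ∧
        (∀ s < 0, ∀ q, ⟪Literature.Analysis.FluidPDE.curl (U s) q, EuclideanSpace.single 2 1⟫_ℝ = 0) ∧
        U (-1) 0 2 ≠ 0 ∧ (∀ t < 0, ∀ x, Real.sqrt (-t) * |U t x 2| ≤ |U (-1) 0 2|) ∧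
        (∀ h : EuclideanSpace ℝ (Fin 3), fderiv ℝ (U (-1)) 0 h 2 = 0) ∧
        (deriv (fun s => U s 0 2) (-1) = U (-1) 0 2 / 2 ∧ U (-1) 0 2 * (Δ (fun q => U (-1) q 2)) 0 ≤ 0)))
    (hK : (∀ (s z₀ σ M : ℝ) (K O : Set (EuclideanSpace ℝ (Fin 3))), s < 0 →
        ((σ = 1 ∨ σ = -1) ∧ IsCompact K ∧ K.Nonempty ∧ (∀ q ∈ K, q 2 = z₀ ∧ σ * U s q 2 = M) ∧
          IsOpen O ∧ K ⊆ O ∧ (∀ q ∈ O, q 2 = z₀ → σ * U s q 2 ≤ M) ∧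
          (∀ q ∈ O, q 2 = z₀ → σ * U s q 2 = M → q ∈ K)) → False))
    {σ₀ : ℝ} {Γ : ℝ → EuclideanSpace ℝ (Fin 3)} {κ₀ : ℝ}
    (hΓs : ContDiff ℝ ∞ Γ) (hΓplane : ∀ s, Γ s 2 = 0) (hΓunit : ∀ s, ‖deriv Γ s‖ = 1)
    (hΓhot : ∀ s, U (-1) (Γ s) 2 = U (-1) 0 2)
    (hκ : ∀ s, κ₀ ≤ -(fderiv ℝ (fderiv ℝ (fun y => σ₀ * U (-1) y 2)) (Γ s)
      (WithLp.toLp 2 ![-(deriv Γ s 1), deriv Γ s 0, 0]) (WithLp.toLp 2 ![-(deriv Γ s 1), deriv Γ s 0, 0])))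
    (σ : ℝ) :
    (Literature.Analysis.FluidPDE.HasTypeITimeDecay C (fun t x => U t (x + Γ σ)) ∧
        ContinuousOn (Function.uncurry (fun t x => U t (x + Γ σ))) (Set.Iio (0 : ℝ) ×ˢ Set.univ) ∧
        (∀ s t : ℝ, s < t → t < 0 → ∀ x, (fun t x => U t (x + Γ σ)) t x =
          Literature.Analysis.UnboundedOperators.heatExtension ((fun t x => U t (x + Γ σ)) s) (t - s) x -
            Literature.Analysis.FluidPDE.oseenDuhamel 1 s (fun t x => U t (x + Γ σ)) (fun t x => U t (x + Γ σ)) t x) ∧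
        (∀ t < 0, Literature.Analysis.FluidPDE.VectorCalculus.IsDivFree ((fun t x => U t (x + Γ σ)) t)) ∧
        (∀ s < 0, ∀ q, ⟪Literature.Analysis.FluidPDE.curl ((fun t x => U t (x + Γ σ)) s) q, EuclideanSpace.single 2 1⟫_ℝ = 0) ∧
        (fun t x => U t (x + Γ σ)) (-1) 0 2 ≠ 0 ∧
        (∀ t < 0, ∀ x, Real.sqrt (-t) * |(fun t x => U t (x + Γ σ)) t x 2| ≤ |(fun t x => U t (x + Γ σ)) (-1) 0 2|) ∧
        (∀ h : EuclideanSpace ℝ (Fin 3), fderiv ℝ ((fun t x => U t (x + Γ σ)) (-1)) 0 h 2 = 0) ∧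
        (deriv (fun s => (fun t x => U t (x + Γ σ)) s 0 2) (-1) = (fun t x => U t (x + Γ σ)) (-1) 0 2 / 2 ∧
          (fun t x => U t (x + Γ σ)) (-1) 0 2 * (Δ (fun q => (fun t x => U t (x + Γ σ)) (-1) q 2)) 0 ≤ 0)) ∧
      (∀ (s z₀ σ' M : ℝ) (K O : Set (EuclideanSpace ℝ (Fin 3))), s < 0 →
        ((σ' = 1 ∨ σ' = -1) ∧ IsCompact K ∧ K.Nonempty ∧ (∀ q ∈ K, q 2 = z₀ ∧ σ' * (fun t x => U t (x + Γ σ)) s q 2 = M) ∧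
          IsOpen O ∧ K ⊆ O ∧ (∀ q ∈ O, q 2 = z₀ → σ' * (fun t x => U t (x + Γ σ)) s q 2 ≤ M) ∧
          (∀ q ∈ O, q 2 = z₀ → σ' * (fun t x => U t (x + Γ σ)) s q 2 = M → q ∈ K)) → False) ∧
      (fun t x => U t (x + Γ σ)) (-1) 0 2 = U (-1) 0 2 ∧
      -- re-entry package of the slid pair
      (∀ y ∈ {y : EuclideanSpace ℝ (Fin 3) | y 2 = 0 ∧ (fun t x => U t (x + Γ σ)) (-1) y 2 = (fun t x => U t (x + Γ σ)) (-1) 0 2},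
        fderiv ℝ (fun x => (fun t x => U t (x + Γ σ)) (-1) x 2) y = 0) ∧
      ContDiff ℝ ∞ (fun s => Γ (s + σ) - Γ σ) ∧ (fun s => Γ (s + σ) - Γ σ) 0 = 0 ∧ (∀ s, (fun s => Γ (s + σ) - Γ σ) s 2 = 0) ∧
      (∀ s, ‖deriv (fun s => Γ (s + σ) - Γ σ) s‖ = 1) ∧
      (∀ s, (fun t x => U t (x + Γ σ)) (-1) ((fun s => Γ (s + σ) - Γ σ) s) 2 = (fun t x => U t (x + Γ σ)) (-1) 0 2) ∧
      (∀ s, κ₀ ≤ -(fderiv ℝ (fderiv ℝ (fun y => σ₀ * (fun t x => U t (x + Γ σ)) (-1) y 2)) ((fun s => Γ (s + σ) - Γ σ) s)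
          (WithLp.toLp 2 ![-(deriv (fun s => Γ (s + σ) - Γ σ) s 1), deriv (fun s => Γ (s + σ) - Γ σ) s 0, 0])
          (WithLp.toLp 2 ![-(deriv (fun s => Γ (s + σ) - Γ σ) s 1), deriv (fun s => Γ (s + σ) - Γ σ) s 0, 0]))) := by
  have hy : Γ σ ∈ {q : EuclideanSpace ℝ (Fin 3) | q 2 = 0 ∧ U (-1) q 2 = U (-1) 0 2} := ⟨hΓplane σ, hΓhot σ⟩
  have hP' := pinned_translate hP hy
  have hK' := peakless_translate hK (Γ σ)
  obtain ⟨hs', h0', hplane', hd', hunit'⟩ := rebased_branch_facts hΓs hΓplane hΓunit σ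
  have hval : (fun t x => U t (x + Γ σ)) (-1) 0 2 = U (-1) 0 2 := by
    show U (-1) (0 + Γ σ) 2 = U (-1) 0 2
    rw [zero_add]; exact hΓhot σ
  refine ⟨hP', hK', hval, fderiv_two_eq_zero_of_hot (U := fun t x => U t (x + Γ σ)) hP'.2.2.2.2.2.2.1, hs', h0', hplane', hunit', fun s => ?_,
    fun s => ?_⟩
  · show U (-1) ((Γ (s + σ) - Γ σ) + Γ σ) 2 = U (-1) (0 + Γ σ) 2
    rw [sub_add_cancel, zero_add, hΓhot, hΓhot]
  · have e : (fun y : EuclideanSpace ℝ (Fin 3) => σ₀ * (fun t x => U t (x + Γ σ)) (-1) y 2) =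
        fun y => (fun q : EuclideanSpace ℝ (Fin 3) => σ₀ * U (-1) q 2) (y + Γ σ) := rfl
    rw [e, fderiv_fderiv_comp_add_right (fun q : EuclideanSpace ℝ (Fin 3) => σ₀ * U (-1) q 2) (Γ σ), hd' s]
    have e2 : (Γ (s + σ) - Γ σ) + Γ σ = Γ (s + σ) := sub_add_cancel _ _
    simp only [e2]
    exact hκ (s + σ)

end Summit.NavierStokesRegularity.NavierStokesRegularity.Theorems.PoloidalWindowDoorLrcModEntireRidgeWebRecurrentSlide

end
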